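import Mathlib
import HarnessLib
import Summits.AtomisticToContinuum.FouriersLaw.Theses.ThermostatLiouville

/-!
# Birth skeleton (BC3) for crux `ThermostatLiouville.EscapeLawOfNoBallisticChannel`
(item `stmt-AtomisticToContinuum-13701`, route `route-AtomisticToContinuum-ThermostatLiouville`, crux rank 4,
sub-problem `FouriersLaw`; registrar `planner-skel-stmt-AtomisticToContinuum-13701-0`, 2026-08-17)

Crux (FIXED, concluded BY NAME below — the route's IMPORT SLOT "ballistic or Fourier at the thermostat"):
for `pinnedChain ω₂ lam β γ` (all `> 0`), under weak-NESS uniqueness, for every `T > 0` there is `κb > 0` such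
that along every steady-state family `μ` and every sequence `e` of boundary responses
(`e N` = derivative at `δ = 0` of `δ ↦ ∫ p_0² dμ_(N+1, T+δ/2, T−δ/2)`):  `e N → 1/2 ⇒ N·γ·(1/2 − e N) → κb`.

## Line `birth` — SERIES LAW AT THE THERMOSTAT × OHMIC FLOOR; Fekete makes "no ballistic channel" load-bearing

Dictionary (route support `ResponseIdentity`, stmt-13703): `D_(N+1) = N·γ·E_N` with `E_N := 1/2 − e N` the first-order
ESCAPE DEFICIT of the thermostatted site, so `r N := 1/(1/2 − e N) = γ·R_(N+1)` is (γ times) the bath-to-bath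
linear-response RESISTANCE of the chain with `N` bonds — the inverse escape deficit read at the thermostat.

* `stub_seriesLaw` (JUNCTION LOCALITY / SUPERADDITIVE RESISTANCE read at the thermostat): along any steady-state
  family and any boundary-response sequence there is a contact constant `c` with
  `r n + r m − c ≤ r (n + m + 1)` for all `n m` — joining an `n`-bond and an `m`-bond chain by one new anharmonic
  bond (equivalently: cutting the long chain at a bond and re-thermalising both new ends at the self-consistent
  temperature) lowers the end-to-end resistance by at most a bounded reservoir-insertion cost.  This is crux (A)
  `SuperadditiveJunction.SuperadditiveResistance` (stmt-AtomisticToContinuum-2191, vetted, moot only because that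
  route was retired `not-a-thesis`, never refuted) transported through the dictionary.  Size XL; load-bearing.
* `stub_ohmicFloor` (NOT INSULATING, with finite-N positivity): `e n < 1/2` for every `n` (positive conductance of
  every finite chain: `SuperadditiveJunction.PositiveConductance`, PROVED in tree for the `D`-language as
  `FeketeSeriesLaw.PositiveConductance`, stmt-11750) and `r n ≤ C·(n+1)` (an Ohmic LOWER bound on the conductance,
  `liminf D_N > 0`: crux (C) `SuperadditiveJunction.ConductanceLowerBound`, stmt-2193, vetted/moot).  Size L–XL.
* COMPOSITION (sorry-free seam `escapeLaw_of_seriesLaw_of_ohmicFloor`, ~120 lines): `u N := c − r (N−1)` (`u 0 := 0`)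
  is SUBADDITIVE on ℕ; the floor bounds `u N / N` below, so Fekete (`Subadditive.tendsto_lim`) gives
  `r N / N → ρ := −lim u N/N ∈ [0, ∞)`; the crux's OWN hypothesis `e N → 1/2` (no ballistic channel ⇔ `r N → ∞`)
  supplies ONE `N₀` with `r N₀ > c`, whence `ρ ≥ (r N₀ − c)/(N₀+1) > 0` (`Subadditive.lim_le_div`) — this is exactly
  the dichotomy "bounded resistance (ballistic) OR linear resistance (Fourier)" that names the crux; then
  `N·γ·(1/2 − e N) = γ·(N/(N+1))/(r N/(N+1)) → γ/ρ =: κb > 0`.  Since `κb` is quantified BEFORE the family, the seam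
  also proves that weak-NESS uniqueness makes the response sequence `e` family-independent (`response_unique`:
  families agree at positive temperatures, `|δ| < 2T` is a neighbourhood of `0`, `HasDerivAt.unique`).

Hardest stub: `stub_seriesLaw`.  Why the cut is not a costume: `stub_seriesLaw` alone is satisfied by the ballistic
harmonic corner (bounded `r`, `SuperadditiveJunction.HarmonicCalibration`) where the crux's conclusion fails without
its hypothesis, and it says nothing about `ρ < ∞`; `stub_ohmicFloor` alone allows `r N ≍ N^(1−α)` (anomalous) or
oscillating `r N / N`, for which `N·γ·E_N` has no limit; neither mentions `κb` or a limit.  BC3 probes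
`stub → EscapeLawOfNoBallisticChannel`, `stub → FouriersLaw` by `first | exact? | simpa | aesop` fail for both stubs
(planner folder `bc/`, quoted in `Lines/birth.md`).
Disproof used: none on file (`ledger crux ls stmt-AtomisticToContinuum-13701`: no workfiles, 2026-08-17); refuter
evidence `escapeLaw_of_fouriersLaw : ResponseIdentity → FouriersLaw → EscapeLawOfNoBallisticChannel` (the converse
direction S → C, hypothesis unused) is respected: this line goes the other way and USES `e N → 1/2`.
-/

noncomputable section

open Filter Topology MeasureTheory

namespace Summit.AtomisticToContinuum.FouriersLaw.Cruxes.EscapeLawOfNoBallisticChannel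

namespace Birth

/-! ## The two registered stubs -/

/-- **stub 1 — `stub_seriesLaw` (series law / junction locality read at the thermostat).**  For
`pinnedChain ω₂ lam β γ` (all `> 0`), under weak-NESS uniqueness, for every `T > 0`, along any steady-state family
`μ` and any boundary-response sequence `e` (`e N` the derivative at `0` of `δ ↦ ∫ p_0² dμ_(N+1,T+δ/2,T−δ/2)`) there is
`c` with `1/(1/2 − e n) + 1/(1/2 − e m) − c ≤ 1/(1/2 − e (n+m+1))` for all `n m : ℕ` (the inverse first-order escape
deficit — γ × the bath-to-bath resistance of the `n`-bond chain — is superadditive in the number of bonds up to a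
contact constant).  = `SuperadditiveJunction.SuperadditiveResistance` (stmt-2191) through `D_(N+1) = N·γ·(1/2 − e N)`. -/
theorem stub_seriesLaw :
    ∀ ω₂ lam β γ : ℝ, 0 < ω₂ → 0 < lam → 0 < β → 0 < γ → (∀ (N : ℕ) (T_L T_R : ℝ), 0 < T_L → 0 < T_R → ∀ μ ν : MeasureTheory.Measure (Literature.MathematicalPhysics.KineticTheory.HeatConduction.PhaseSpace N), (Literature.MathematicalPhysics.KineticTheory.HeatConduction.pinnedChain ω₂ lam β γ).IsSteadyState N T_L T_R μ → (Literature.MathematicalPhysics.KineticTheory.HeatConduction.pinnedChain ω₂ lam β γ).IsSteadyState N T_L T_R ν → μ = ν) → ∀ T : ℝ, 0 < T → ∀ μ : (N : ℕ) → ℝ → ℝ → MeasureTheory.Measure (Literature.MathematicalPhysics.KineticTheory.HeatConduction.PhaseSpace N), (∀ (N : ℕ) (T_L T_R : ℝ), 0 < T_L → 0 < T_R → (Literature.MathematicalPhysics.KineticTheory.HeatConduction.pinnedChain ω₂ lam β γ).IsSteadyState N T_L T_R (μ N T_L T_R)) → ∀ e : ℕ → ℝ, (∀ N : ℕ, HasDerivAt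 (fun δ : ℝ => ∫ x, (x.2 (0 : Fin (N + 1))) ^ 2 ∂(μ (N + 1) (T + δ / 2) (T - δ / 2))) (e N) 0) → ∃ c : ℝ, ∀ n m : ℕ, 1 / (1 / 2 - e n) + 1 / (1 / 2 - e m) - c ≤ 1 / (1 / 2 - e (n + m + 1)) := by
  sorry

/-- **stub 2 — `stub_ohmicFloor` (not insulating, with finite-N positivity, read at the thermostat).**  For
`pinnedChain ω₂ lam β γ` (all `> 0`), under weak-NESS uniqueness, for every `T > 0`, along any steady-state family
and any boundary-response sequence `e` there is `C` with, for every `n : ℕ`, `e n < 1/2` (positive first-order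
escape deficit = positive conductance of the `(n+1)`-site chain, `FeketeSeriesLaw.PositiveConductance` in
`D`-language; `e 0 = 0` for the one-site chain) and `1/(1/2 − e n) ≤ C·(n+1)` (resistance at most linear in the
length = an Ohmic LOWER bound `D_(n+1) ≥ γ/(2C)`, `SuperadditiveJunction.ConductanceLowerBound`, stmt-2193). -/
theorem stub_ohmicFloor :
    ∀ ω₂ lam β γ : ℝ, 0 < ω₂ → 0 < lam → 0 < β → 0 < γ → (∀ (N : ℕ) (T_L T_R : ℝ), 0 < T_L → 0 < T_R → ∀ μ ν : MeasureTheory.Measure (Literature.MathematicalPhysics.KineticTheory.HeatConduction.PhaseSpace N), (Literature.MathematicalPhysics.KineticTheory.HeatConduction.pinnedChain ω₂ lam β γ).IsSteadyState N T_L T_R μ → (Literature.MathematicalPhysics.KineticTheory.HeatConduction.pinnedChain ω₂ lam β γ).IsSteadyState N T_L T_R ν → μ = ν) → ∀ T : ℝ, 0 < T → ∀ μ : (N : ℕ) → ℝ → ℝ → MeasureTheory.Measure (Literature.MathematicalPhysics.KineticTheory.HeatConduction.PhaseSpace N), (∀ (N : ℕ) (T_L T_R : ℝ), 0 < T_L →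 0 < T_R → (Literature.MathematicalPhysics.KineticTheory.HeatConduction.pinnedChain ω₂ lam β γ).IsSteadyState N T_L T_R (μ N T_L T_R)) → ∀ e : ℕ → ℝ, (∀ N : ℕ, HasDerivAt (fun δ : ℝ => ∫ x, (x.2 (0 : Fin (N + 1))) ^ 2 ∂(μ (N + 1) (T + δ / 2) (T - δ / 2))) (e N) 0) → ∃ C : ℝ, ∀ n : ℕ, e n < 1 / 2 ∧ 1 / (1 / 2 - e n) ≤ C * ((n : ℝ) + 1) := by
  sorry

/-! ## Real analysis: Fekete with defect, driven by "no ballistic channel" (all sorry-free) -/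

/-- **The analytic heart of the line.**  If `r n := 1/(1/2 − e n)` is superadditive up to `c` under joining by
one bond (`r n + r m − c ≤ r (n+m+1)`), positive and at most linear (`e n < 1/2`, `r n ≤ C (n+1)`), and
`e n → 1/2` (NO BALLISTIC CHANNEL: `r n → ∞`), then `n·γ·(1/2 − e n) → κb` for some `κb > 0`.
Proof: `u N := c − r (N−1)` (`u 0 := 0`) is subadditive with `u N/N ≥ −(|c|+|C|)`; Fekete gives
`u N/N → L = inf_(N≥1) u N/N`; one `N₀` with `r N₀ > c` (from `e → 1/2`) gives `L < 0`; then
`r n/(n+1) → −L > 0` and `n·γ·(1/2 − e n) = γ·(n/(n+1))/(r n/(n+1)) → γ/(−L)`. -/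
theorem fekete_core (e : ℕ → ℝ) (c C γ : ℝ) (hγ : 0 < γ)
    (hS : ∀ n m : ℕ, 1 / (1 / 2 - e n) + 1 / (1 / 2 - e m) - c ≤ 1 / (1 / 2 - e (n + m + 1)))
    (hF : ∀ n : ℕ, e n < 1 / 2 ∧ 1 / (1 / 2 - e n) ≤ C * ((n : ℝ) + 1))
    (hlim : Tendsto e atTop (𝓝 (1 / 2 : ℝ))) :
    ∃ κb : ℝ, 0 < κb ∧ Tendsto (fun N : ℕ => (N : ℝ) * γ * (1 / 2 - e N)) atTop (𝓝 κb) := by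
  -- the resistance sequence
  set r : ℕ → ℝ := fun n => 1 / (1 / 2 - e n) with hr
  have hE : ∀ n, 0 < 1 / 2 - e n := fun n => sub_pos.mpr (hF n).1
  have hrpos : ∀ n, 0 < r n := fun n => one_div_pos.mpr (hE n)
  have hrC : ∀ n, r n ≤ C * ((n : ℝ) + 1) := fun n => (hF n).2
  have hS' : ∀ n m, r n + r m - c ≤ r (n + m + 1) := fun n m => hS n m
  -- the subadditive sequence (index = number of sites)
  set u : ℕ → ℝ := fun N => if N = 0 then 0 else c - r (N - 1) with hu_def
  have hu : Subadditive u := by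
    intro m n
    rcases Nat.eq_zero_or_pos m with rfl | hm
    · simp [hu_def]
    rcases Nat.eq_zero_or_pos n with rfl | hn
    · simp [hu_def]
    have hm0 : m ≠ 0 := Nat.pos_iff_ne_zero.mp hm
    have hn0 : n ≠ 0 := Nat.pos_iff_ne_zero.mp hn
    have hmn0 : m + n ≠ 0 := by omega
    simp only [hu_def, hm0, hn0, hmn0, if_false]
    have h := hS' (m - 1) (n - 1)
    have h1 : m - 1 + (n - 1) + 1 = m + n - 1 := by omega
    rw [h1] at h
    linarith
  -- bounded below
  have hbdd : BddBelow (Set.range fun N => u N / N) := by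
    refine ⟨-(|c| + |C|), ?_⟩
    rintro _ ⟨N, rfl⟩
    rcases Nat.eq_zero_or_pos N with rfl | hN
    · simp only [hu_def, if_true, Nat.cast_zero, div_zero]
      have : 0 ≤ |c| + |C| := by positivity
      linarith
    · have hN0 : N ≠ 0 := Nat.pos_iff_ne_zero.mp hN
      simp only [hu_def, hN0, if_false]
      have hcast : (((N - 1 : ℕ) : ℝ)) + 1 = (N : ℝ) := by
        have h1N : 1 ≤ N := hN
        rw [Nat.cast_sub h1N, Nat.cast_one]
        ring
      have hrle : r (N - 1) ≤ C * (N : ℝ) := by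
        have h := hrC (N - 1)
        rwa [hcast] at h
      have hNpos : (0 : ℝ) < N := by exact_mod_cast hN
      have hN1 : (1 : ℝ) ≤ N := by exact_mod_cast hN
      rw [le_div_iff₀ hNpos]
      have h1 : -|c| ≤ c := neg_abs_le c
      have h2 : C ≤ |C| := le_abs_self C
      have hc0 : 0 ≤ |c| := abs_nonneg c
      have hC0 : 0 ≤ |C| := abs_nonneg C
      nlinarith [hrle, h1, h2, hN1, hc0, hC0, mul_le_mul_of_nonneg_right h2 hNpos.le,
        mul_le_mul_of_nonneg_left hN1 hc0]
  -- Fekete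
  have hlimu : Tendsto (fun N => u N / N) atTop (𝓝 hu.lim) := hu.tendsto_lim hbdd
  set L := hu.lim with hL_def
  -- no ballistic channel ⇒ one length with resistance above the contact constant
  have hbig : ∃ n, c < r n := by
    have hε : (0 : ℝ) < 1 / (|c| + 1) := by positivity
    obtain ⟨N, hN⟩ := (Metric.tendsto_atTop.mp hlim) (1 / (|c| + 1)) hε
    refine ⟨N, ?_⟩
    have hd := hN N le_rfl
    rw [Real.dist_eq] at hd
    have h1 : 1 / 2 - e N < 1 / (|c| + 1) := by
      have h := (abs_lt.mp hd).1
      linarith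
    have h2 : |c| + 1 < r N := by
      have h3 : |c| + 1 < 1 / (1 / 2 - e N) := by
        rw [lt_one_div (by positivity) (hE N)]
        exact h1
      simpa [hr] using h3
    linarith [le_abs_self c]
  obtain ⟨n₀, hn₀⟩ := hbig
  have hL : L < 0 := by
    have h := hu.lim_le_div hbdd (n := n₀ + 1) (Nat.succ_ne_zero n₀)
    have hneg : u (n₀ + 1) / ((n₀ + 1 : ℕ) : ℝ) < 0 := by
      have hu1 : u (n₀ + 1) = c - r n₀ := by
        simp [hu_def]
      rw [hu1]
      apply div_neg_of_neg_of_pos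
      · linarith
      · positivity
    exact lt_of_le_of_lt h hneg
  -- limits
  have h1 : Tendsto (fun n : ℕ => u (n + 1) / ((n + 1 : ℕ) : ℝ)) atTop (𝓝 L) :=
    hlimu.comp (tendsto_add_atTop_nat 1)
  have h1' : Tendsto (fun n : ℕ => (c - r n) / ((n : ℝ) + 1)) atTop (𝓝 L) := by
    refine h1.congr (fun n => ?_)
    have hu1 : u (n + 1) = c - r n := by simp [hu_def]
    rw [hu1]
    push_cast
    rfl
  have hc0 : Tendsto (fun n : ℕ => c / ((n : ℝ) + 1)) atTop (𝓝 0) := by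
    have h := (tendsto_const_div_atTop_nhds_zero_nat c).comp (tendsto_add_atTop_nat 1)
    refine h.congr (fun n => ?_)
    simp only [Function.comp_apply]
    push_cast
    rfl
  have h2 : Tendsto (fun n : ℕ => r n / ((n : ℝ) + 1)) atTop (𝓝 (-L)) := by
    have h3 : (fun n : ℕ => r n / ((n : ℝ) + 1)) =
        fun n : ℕ => c / ((n : ℝ) + 1) - (c - r n) / ((n : ℝ) + 1) := by
      funext n
      ring
    rw [h3]
    have h := hc0.sub h1'
    simpa using h
  have h4 : Tendsto (fun n : ℕ => (n : ℝ) / ((n : ℝ) + 1)) atTop (𝓝 1) :=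
    tendsto_natCast_div_add_atTop (1 : ℝ)
  have hLne : (-L) ≠ 0 := neg_ne_zero.mpr hL.ne
  have h5 : Tendsto (fun n : ℕ => γ * ((n : ℝ) / ((n : ℝ) + 1)) / (r n / ((n : ℝ) + 1))) atTop
      (𝓝 (γ * 1 / (-L))) :=
    (h4.const_mul γ).div h2 hLne
  have h6 : ∀ n : ℕ, γ * ((n : ℝ) / ((n : ℝ) + 1)) / (r n / ((n : ℝ) + 1)) =
      (n : ℝ) * γ * (1 / 2 - e n) := by
    intro n
    have hn1 : (n : ℝ) + 1 ≠ 0 := by positivity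
    have hEn : 1 / 2 - e n ≠ 0 := (hE n).ne'
    simp only [hr]
    field_simp
  refine ⟨γ / (-L), div_pos hγ (neg_pos.mpr hL), ?_⟩
  rw [mul_one] at h5
  exact h5.congr (fun n => h6 n)

/-! ## Weak-NESS uniqueness makes the boundary response family-independent (sorry-free) -/

/-- Under weak-NESS uniqueness, two steady-state families agree at positive temperatures, so their boundary
response maps `δ ↦ ∫ p_0² dμ_(N+1, T+δ/2, T−δ/2)` agree on the neighbourhood `|δ| < 2T` of `0`, and the derivatives
at `0` coincide (`HasDerivAt.unique`).  This is why `κb` may be chosen before the family in the crux. -/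
theorem response_unique {ω₂ lam β γ : ℝ}
    (huniq : ∀ (N : ℕ) (T_L T_R : ℝ), 0 < T_L → 0 < T_R → ∀ μ ν : MeasureTheory.Measure (Literature.MathematicalPhysics.KineticTheory.HeatConduction.PhaseSpace N), (Literature.MathematicalPhysics.KineticTheory.HeatConduction.pinnedChain ω₂ lam β γ).IsSteadyState N T_L T_R μ → (Literature.MathematicalPhysics.KineticTheory.HeatConduction.pinnedChain ω₂ lam β γ).IsSteadyState N T_L T_R ν → μ = ν)
    {T : ℝ} (hT : 0 < T)
    {μ₁ μ₂ : (N : ℕ) → ℝ → ℝ → MeasureTheory.Measure (Literature.MathematicalPhysics.KineticTheory.HeatConduction.PhaseSpace N)}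
    (h₁ : ∀ (N : ℕ) (T_L T_R : ℝ), 0 < T_L → 0 < T_R → (Literature.MathematicalPhysics.KineticTheory.HeatConduction.pinnedChain ω₂ lam β γ).IsSteadyState N T_L T_R (μ₁ N T_L T_R))
    (h₂ : ∀ (N : ℕ) (T_L T_R : ℝ), 0 < T_L → 0 < T_R → (Literature.MathematicalPhysics.KineticTheory.HeatConduction.pinnedChain ω₂ lam β γ).IsSteadyState N T_L T_R (μ₂ N T_L T_R))
    {e₁ e₂ : ℕ → ℝ}
    (he₁ : ∀ N : ℕ, HasDerivAt (fun δ : ℝ => ∫ x, (x.2 (0 : Fin (N + 1))) ^ 2 ∂(μ₁ (N + 1) (T + δ / 2) (T - δ / 2))) (e₁ N) 0)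
    (he₂ : ∀ N : ℕ, HasDerivAt (fun δ : ℝ => ∫ x, (x.2 (0 : Fin (N + 1))) ^ 2 ∂(μ₂ (N + 1) (T + δ / 2) (T - δ / 2))) (e₂ N) 0) :
    e₁ = e₂ := by
  funext N
  have hEq : (fun δ : ℝ => ∫ x, (x.2 (0 : Fin (N + 1))) ^ 2 ∂(μ₁ (N + 1) (T + δ / 2) (T - δ / 2))) =ᶠ[𝓝 0]
      (fun δ : ℝ => ∫ x, (x.2 (0 : Fin (N + 1))) ^ 2 ∂(μ₂ (N + 1) (T + δ / 2) (T - δ / 2))) := by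
    have hopen : Set.Ioo (-(2 * T)) (2 * T) ∈ 𝓝 (0 : ℝ) := Ioo_mem_nhds (by linarith) (by linarith)
    filter_upwards [hopen] with δ hδ
    have ha : 0 < T + δ / 2 := by linarith [hδ.1]
    have hb : 0 < T - δ / 2 := by linarith [hδ.2]
    have hμ : μ₁ (N + 1) (T + δ / 2) (T - δ / 2) = μ₂ (N + 1) (T + δ / 2) (T - δ / 2) :=
      huniq (N + 1) _ _ ha hb _ _ (h₁ (N + 1) _ _ ha hb) (h₂ (N + 1) _ _ ha hb)
    rw [hμ]
  exact (he₁ N).unique (hEq.hasDerivAt_iff.mpr (he₂ N))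

/-! ## The composition -/

/-- **The implication, sorry-free** (axioms `propext`, `Classical.choice`, `Quot.sound`):
`stub_seriesLaw`-statement → `stub_ohmicFloor`-statement → the statement of
`ThermostatLiouville.EscapeLawOfNoBallisticChannel` (conclusion = the crux's definiens VERBATIM, so that
`EscapeLawOfNoBallisticChannel_of` below is this term at the crux's name).  `κb` is produced from ANY admissible
triple (family, responses, `e → 1/2`) by `fekete_core` and transported to every other family by `response_unique`;
if no admissible triple exists the conclusion is vacuous (`κb := 1`). -/
theorem escapeLaw_of_seriesLaw_of_ohmicFloor :
    (∀ ω₂ lam β γ : ℝ, 0 < ω₂ → 0 < lam → 0 < β → 0 < γ → (∀ (N : ℕ) (T_L T_R : ℝ), 0 < T_L → 0 < T_R → ∀ μ ν : MeasureTheory.Measure (Literature.MathematicalPhysics.KineticTheory.HeatConduction.PhaseSpace N), (Literature.MathematicalPhysics.KineticTheory.HeatConduction.pinnedChain ω₂ lam β γ).IsSteadyState N T_L T_R μ → (Literature.MathematicalPhysics.KineticTheory.HeatConduction.pinnedChain ω₂ lam β γ).IsSteadyState N T_L T_R ν → μ = ν) → ∀ T : ℝ, 0 < T → ∀ μ : (N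 : ℕ) → ℝ → ℝ → MeasureTheory.Measure (Literature.MathematicalPhysics.KineticTheory.HeatConduction.PhaseSpace N), (∀ (N : ℕ) (T_L T_R : ℝ), 0 < T_L → 0 < T_R → (Literature.MathematicalPhysics.KineticTheory.HeatConduction.pinnedChain ω₂ lam β γ).IsSteadyState N T_L T_R (μ N T_L T_R)) → ∀ e : ℕ → ℝ, (∀ N : ℕ, HasDerivAt (fun δ : ℝ => ∫ x, (x.2 (0 : Fin (N + 1))) ^ 2 ∂(μ (N + 1) (T + δ / 2) (T - δ / 2))) (e N) 0) → ∃ c : ℝ, ∀ n m : ℕ, 1 / (1 / 2 - e n) + 1 / (1 / 2 - e m) - c ≤ 1 / (1 / 2 - e (n + m + 1))) →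
    (∀ ω₂ lam β γ : ℝ, 0 < ω₂ → 0 < lam → 0 < β → 0 < γ → (∀ (N : ℕ) (T_L T_R : ℝ), 0 < T_L → 0 < T_R → ∀ μ ν : MeasureTheory.Measure (Literature.MathematicalPhysics.KineticTheory.HeatConduction.PhaseSpace N), (Literature.MathematicalPhysics.KineticTheory.HeatConduction.pinnedChain ω₂ lam β γ).IsSteadyState N T_L T_R μ → (Literature.MathematicalPhysics.KineticTheory.HeatConduction.pinnedChain ω₂ lam β γ).IsSteadyState N T_L T_R ν → μ = ν) → ∀ T : ℝ, 0 < T → ∀ μ : (N : ℕ) → ℝ → ℝ → MeasureTheory.Measure (Literature.MathematicalPhysics.KineticTheory.HeatConduction.PhaseSpace N), (∀ (N : ℕ) (T_L T_R : ℝ), 0 < T_L → 0 < T_R → (Literature.MathematicalPhysics.KineticTheory.HeatConduction.pinnedChain ω₂ lam β γ).IsSteadyState N T_L T_R (μ N T_L T_R)) → ∀ e : ℕ → ℝ, (∀ N : ℕ, HasDerivAt (fun δ : ℝ => ∫ x, (x.2 (0 : Fin (N + 1))) ^ 2 ∂(μ (N + 1) (T + δ / 2) (T - δ / 2))) (e N)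 0) → ∃ C : ℝ, ∀ n : ℕ, e n < 1 / 2 ∧ 1 / (1 / 2 - e n) ≤ C * ((n : ℝ) + 1)) →
    (∀ ω₂ lam β γ : ℝ, 0 < ω₂ → 0 < lam → 0 < β → 0 < γ → (∀ (N : ℕ) (T_L T_R : ℝ), 0 < T_L → 0 < T_R → ∀ μ ν : MeasureTheory.Measure (Literature.MathematicalPhysics.KineticTheory.HeatConduction.PhaseSpace N), (Literature.MathematicalPhysics.KineticTheory.HeatConduction.pinnedChain ω₂ lam β γ).IsSteadyState N T_L T_R μ → (Literature.MathematicalPhysics.KineticTheory.HeatConduction.pinnedChain ω₂ lam β γ).IsSteadyState N T_L T_R ν → μ = ν) → ∀ T : ℝ, 0 < T → ∃ κb : ℝ, 0 < κb ∧ ∀ μ : (N : ℕ) → ℝ → ℝ → MeasureTheory.Measure (Literature.MathematicalPhysics.KineticTheory.HeatConduction.PhaseSpace N), (∀ (N : ℕ) (T_L T_R : ℝ), 0 < T_L → 0 < T_R → (Literature.MathematicalPhysics.KineticTheory.HeatConduction.pinnedChain ω₂ lam β γ).IsSteadyState N T_L T_R (μ N T_L T_R)) → ∀ e : ℕ → ℝ,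 (∀ N : ℕ, HasDerivAt (fun δ : ℝ => ∫ x, (x.2 (0 : Fin (N + 1))) ^ 2 ∂(μ (N + 1) (T + δ / 2) (T - δ / 2))) (e N) 0) → Filter.Tendsto e Filter.atTop (nhds (1 / 2 : ℝ)) → Filter.Tendsto (fun N : ℕ => (N : ℝ) * γ * (1 / 2 - e N)) Filter.atTop (nhds κb)) := by
  intro hS hF ω₂ lam β γ hω hl hβ hγ huniq T hT
  classical
  by_cases hex : ∃ (μ : (N : ℕ) → ℝ → ℝ → MeasureTheory.Measure (Literature.MathematicalPhysics.KineticTheory.HeatConduction.PhaseSpace N)) (e : ℕ → ℝ),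
      (∀ (N : ℕ) (T_L T_R : ℝ), 0 < T_L → 0 < T_R → (Literature.MathematicalPhysics.KineticTheory.HeatConduction.pinnedChain ω₂ lam β γ).IsSteadyState N T_L T_R (μ N T_L T_R)) ∧
      (∀ N : ℕ, HasDerivAt (fun δ : ℝ => ∫ x, (x.2 (0 : Fin (N + 1))) ^ 2 ∂(μ (N + 1) (T + δ / 2) (T - δ / 2))) (e N) 0) ∧
      Filter.Tendsto e Filter.atTop (nhds (1 / 2 : ℝ))
  · obtain ⟨μ₀, e₀, hμ₀, he₀, hlim₀⟩ := hex
    obtain ⟨c, hc⟩ := hS ω₂ lam β γ hω hl hβ hγ huniq T hT μ₀ hμ₀ e₀ he₀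
    obtain ⟨C, hC⟩ := hF ω₂ lam β γ hω hl hβ hγ huniq T hT μ₀ hμ₀ e₀ he₀
    obtain ⟨κb, hκb, hconv⟩ := fekete_core e₀ c C γ hγ hc hC hlim₀
    refine ⟨κb, hκb, fun μ hμ e he _hlim => ?_⟩
    have hee : e = e₀ := response_unique huniq hT hμ hμ₀ he he₀
    rw [hee]
    exact hconv
  · refine ⟨1, one_pos, fun μ hμ e he hlim => ?_⟩
    exact absurd ⟨μ, e, hμ, he, hlim⟩ hex

/-- **Skeleton theorem — the crux `ThermostatLiouville.EscapeLawOfNoBallisticChannel` BY NAME from the two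
registered stubs** (the only theorem of this file concluding the crux; its `sorry`s are exactly those of
`stub_seriesLaw` and `stub_ohmicFloor`; the seam is the sorry-free `escapeLaw_of_seriesLaw_of_ohmicFloor`). -/
theorem EscapeLawOfNoBallisticChannel_of :
    _root_.Summit.AtomisticToContinuum.FouriersLaw.Theses.ThermostatLiouville.EscapeLawOfNoBallisticChannel :=
  escapeLaw_of_seriesLaw_of_ohmicFloor stub_seriesLaw stub_ohmicFloor

end Birth

end Summit.AtomisticToContinuum.FouriersLaw.Cruxes.EscapeLawOfNoBallisticChannel

end
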